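import Literature.Probability.RandomPlanarGeometry.LatticeSlitIncrements
import Mathlib.Analysis.Complex.OpenMapping
import HarnessLib

/-!
# The capacity displacement bound `|g_K(z) - z| · Im g_K(z) ≤ hcap(K)`

Topic `Literature/Probability/RandomPlanarGeometry` (hydrodynamically normalized conformal maps
`g : ℍ ∖ K → ℍ`, `g(z) - z → 0` at `∞`, `IsHydrodynamicMap`, `HydrodynamicMaps.lean`; their
half-plane capacity `hcap K g = lim z (g(z) - z)`, Lawler (2005), Def. 3.37). The tree bounds the
displacement `|g(z) - z|` by the RADIUS of the hull (`IsHydrodynamicMap.norm_sub_self_le`, Lawler's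
(3.12) `|g_A(z) - z| ≤ 3 rad(A)`). Here is the bound by the CAPACITY, uniform in the diameter:

* `IsHydrodynamicMap.norm_sub_self_sq_mul_im_le` — **`|g(z) - z|² Im g(z) ≤ hcap(K) (Im z - Im g(z))`**;
* `IsHydrodynamicMap.norm_sub_self_mul_im_le_hcap` — **`|g(z) - z| · Im g(z) ≤ hcap(K)`** for
  `z ∈ ℍ ∖ K`, i.e. `|g_K(z) - z| ≤ hcap(K)/Im g_K(z)`: a hull of small capacity moves high
  points little, however long it is;
* the same for the tree's choice `hydroFun K` / `hcapOf K` (`norm_hydroFun_sub_self_mul_im_le`)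
  and for the hull of a lattice past, `|g_{K_η}(z) - z| · Im g_{K_η}(z) ≤ 2 t_η`
  (`LatticeSlit.norm_hydroFun_pastHull_sub_self_mul_im_le`).

Proof (function-theoretic; classically this is read off the Nevanlinna representation
`f(w) - w = ∫ μ(dx)/(x - w)`, `μ(ℝ) = hcap`, of the inverse map `f = g⁻¹`): `E = f - id` is
holomorphic on `ℍ` with `Im E ≥ 0` (`Im g ≤ Im`, Lawler's (3.7)), `E → 0` and `w E(w) → -hcap`
at `∞`. Unless `E ≡ 0`, `E` is a holomorphic self-map of `ℍ` (open mapping), and the two-point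
Schwarz–Pick inequality of the tree (`HalfPlanePick.norm_sub_sq_mul_le`) at the pair `(w, iy)`,
divided by `y` and let `y → ∞`, reads `|E(w)|² Im w ≤ hcap · Im E(w)`.

## References

* G. F. Lawler, *Conformally Invariant Processes in the Plane*, AMS (2005), §3.4, Prop. 3.36,
  Def. 3.37, (3.7), (3.12) [Lawler2005].
* L. V. Ahlfors, *Complex Analysis*, 3rd ed. (1979), Ch. 4 §3.4 (Schwarz–Pick).
-/

noncomputable section

open Set Filter Topology Metric Bornology Complex
open UpperHalfPlane (upperHalfPlaneSet isOpen_upperHalfPlaneSet)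
open Literature.Probability.LatticeModels (meshPoint discreteDomainGraph Site)

namespace Literature.Probability.RandomPlanarGeometry

namespace IsHydrodynamicMap

variable {K : Set ℂ} {φ : ConformalEquiv (upperHalfPlaneSet \ K) upperHalfPlaneSet}

/-- The ray `y ↦ iy` tends to `∞` inside `ℍ`. [folklore] -/
theorem tendsto_I_mul_atTop_cocompact_inf :
    Tendsto (fun y : ℝ ↦ I * (y : ℂ)) atTop (cocompact ℂ ⊓ 𝓟 upperHalfPlaneSet) := by
  refine tendsto_inf.2 ⟨?_, tendsto_principal.2 ?_⟩
  · rw [← cobounded_eq_cocompact, ← tendsto_norm_atTop_iff_cobounded]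
    have : (fun y : ℝ ↦ ‖I * (y : ℂ)‖) =ᶠ[atTop] fun y ↦ y := by
      filter_upwards [eventually_ge_atTop 0] with y hy
      rw [norm_mul, norm_I, one_mul, norm_real, Real.norm_eq_abs, abs_of_nonneg hy]
    exact (tendsto_congr' this).2 tendsto_id
  · filter_upwards [eventually_gt_atTop 0] with y hy
    show 0 < (I * (y : ℂ)).im
    simpa using hy

/-- **`φ⁻¹` tends to `∞` in `ℍ ∖ K` as its argument tends to `∞` in `ℍ`.** [folklore] -/
theorem tendsto_symm_cocompact (hφ : IsHydrodynamicMap K φ) (hb : IsBounded (K ∩ upperHalfPlaneSet)) :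
    Tendsto φ.symm (cocompact ℂ ⊓ 𝓟 upperHalfPlaneSet) (cocompact ℂ ⊓ 𝓟 (upperHalfPlaneSet \ K)) := by
  refine tendsto_inf.2 ⟨?_, tendsto_principal.2 ?_⟩
  · exact tendsto_cocompact_of_sub_self inf_le_left (hφ.tendsto_symm_sub_self hb)
  · filter_upwards [mem_inf_of_right (mem_principal_self _)] with w hw
    exact φ.symm_mapsTo hw

/-- **`w (φ⁻¹(w) - w) → -hcap`** at `∞` in `ℍ` (from `z (φ(z) - z) → hcap` at `z = φ⁻¹(w)`).
[cite: Lawler2005, §3.4 Def. 3.37] -/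
theorem tendsto_mul_symm_sub_self (hφ : IsHydrodynamicMap K φ) (hb : IsBounded (K ∩ upperHalfPlaneSet)) :
    Tendsto (fun w ↦ w * (φ.symm w - w)) (cocompact ℂ ⊓ 𝓟 upperHalfPlaneSet)
      (𝓝 (-(hcap K φ : ℂ))) := by
  have h1 := (hφ.tendsto_mul_sub_self hb).comp (hφ.tendsto_symm_cocompact hb)
  have h2 := hφ.tendsto_symm_sub_self hb
  -- `w E(w) = -[ψ(w) (φ(ψ w) - ψ w)] - E(w)²`
  have h3 := (h1.neg).sub (h2.mul h2)
  rw [mul_zero, sub_zero] at h3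
  refine h3.congr' ?_
  filter_upwards [mem_inf_of_right (mem_principal_self _)] with w hw
  simp only [Function.comp_apply, φ.apply_symm_apply hw]
  ring

/-- `Im φ⁻¹(w) ≥ Im w` on `ℍ` (the inverse of `Im φ ≤ Im`). [cite: Lawler2005, §3.4 (3.7)] -/
theorem im_le_im_symm (hφ : IsHydrodynamicMap K φ) (hb : IsBounded (K ∩ upperHalfPlaneSet)) {w : ℂ}
    (hw : w ∈ upperHalfPlaneSet) : w.im ≤ (φ.symm w).im := by
  have := hφ.im_le hb (φ.symm_mapsTo hw)
  rwa [φ.apply_symm_apply hw] at this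

/-- **The capacity displacement bound, sharp form**: `|φ(z) - z|² Im φ(z) ≤ hcap · (Im z - Im φ(z))`
for `z ∈ ℍ ∖ K`. (Two-point Schwarz–Pick for the self-map `E = φ⁻¹ - id` of `ℍ` at `(φ z, iy)`,
`y → ∞`; if `E` is not a self-map of `ℍ` it vanishes identically.) [cite: Lawler2005, §3.4 Prop. 3.36] -/
theorem norm_sub_self_sq_mul_im_le (hφ : IsHydrodynamicMap K φ) (hb : IsBounded (K ∩ upperHalfPlaneSet))
    {z : ℂ} (hz : z ∈ upperHalfPlaneSet \ K) :
    ‖φ z - z‖ ^ 2 * (φ z).im ≤ hcap K φ * (z.im - (φ z).im) := by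
  set E : ℂ → ℂ := fun w ↦ φ.symm w - w with hE
  have hw : φ z ∈ upperHalfPlaneSet := φ.mapsTo hz
  have hEw : E (φ z) = z - φ z := by simp [hE, φ.symm_apply_apply hz]
  have hEd : DifferentiableOn ℂ E upperHalfPlaneSet := φ.symm.differentiableOn.sub differentiableOn_id
  have hEim : ∀ w ∈ upperHalfPlaneSet, 0 ≤ (E w).im := fun w hw' ↦ by
    simp only [hE, sub_im, sub_nonneg]
    exact hφ.im_le_im_symm hb hw'
  have hcap0 : 0 ≤ hcap K φ := hφ.hcap_nonneg hb
  haveI : (cocompact ℂ ⊓ 𝓟 upperHalfPlaneSet).NeBot := by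
    have := neBot_cocompact_inf (K := (∅ : Set ℂ)) (by simp)
    simpa using this
  -- either `E` is constant (then `E ≡ 0`) or `E` is open, hence a self-map of `ℍ`
  rcases (hEd.analyticOnNhd isOpen_upperHalfPlaneSet).is_constant_or_isOpen
    ((convex_halfSpace_im_gt 0).isPreconnected) with ⟨c, hc⟩ | hopen
  · have hc0 : c = 0 := by
      have h1 : Tendsto E (cocompact ℂ ⊓ 𝓟 upperHalfPlaneSet) (𝓝 c) := by
        refine tendsto_const_nhds.congr' ?_
        filter_upwards [mem_inf_of_right (mem_principal_self _)] with w hw' using (hc w hw').symm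
      exact tendsto_nhds_unique h1 (hφ.tendsto_symm_sub_self hb)
    have : z - φ z = 0 := by rw [← hEw, hc _ hw, hc0]
    rw [sub_eq_zero] at this
    rw [← this, sub_self, norm_zero]
    simp
  -- `E` maps `ℍ` into `ℍ`
  have hmaps : MapsTo E upperHalfPlaneSet upperHalfPlaneSet := by
    intro w₀ hw₀
    by_contra hneg
    have him0 : (E w₀).im = 0 := le_antisymm (not_lt.1 hneg) (hEim w₀ hw₀)
    have hO := hopen upperHalfPlaneSet Subset.rfl isOpen_upperHalfPlaneSet
    obtain ⟨ε, hε, hball⟩ := Metric.isOpen_iff.1 hO (E w₀) ⟨w₀, hw₀, rfl⟩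
    have hmem : E w₀ - (ε / 2 : ℝ) * I ∈ ball (E w₀) ε := by
      rw [mem_ball, dist_eq_norm, sub_sub_cancel_left, norm_neg, norm_mul, norm_real, norm_I,
        mul_one, Real.norm_eq_abs, abs_of_pos (by positivity)]
      linarith
    obtain ⟨w₁, hw₁, hEq⟩ := hball hmem
    have := hEim w₁ hw₁
    rw [hEq] at this
    simp [him0] at this
    linarith
  -- the Schwarz–Pick inequality at `(φ z, iy)`, divided by `y`
  set w := φ z with hwdef
  have hineq : ∀ᶠ y : ℝ in atTop, ‖E w - E (I * y)‖ ^ 2 * w.im ≤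
      ‖w / y - I‖ ^ 2 * ((E w).im * (y * (E (I * y)).im)) := by
    filter_upwards [eventually_gt_atTop 0] with y hy
    have hyH : (I * (y : ℂ)) ∈ upperHalfPlaneSet := by show 0 < (I * (y : ℂ)).im; simpa using hy
    have hSP := HalfPlanePick.norm_sub_sq_mul_le hEd hmaps hw hyH
    have hIy : (I * (y : ℂ)).im = y := by simp
    rw [hIy] at hSP
    have hny : ‖(y : ℂ)‖ = y := by rw [norm_real, Real.norm_eq_abs, abs_of_pos hy]
    have hy0 : (y : ℂ) ≠ 0 := ofReal_ne_zero.2 hy.ne'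
    have h1 : ‖w - I * y‖ = y * ‖w / y - I‖ := by
      have : w - I * y = y * (w / y - I) := by field_simp
      rw [this, norm_mul, hny]
    rw [h1] at hSP
    have key : y * (‖E w - E (I * y)‖ ^ 2 * w.im) ≤
        y * (‖w / y - I‖ ^ 2 * ((E w).im * (y * (E (I * y)).im))) := by
      convert hSP using 1 <;> ring
    exact le_of_mul_le_mul_left key hy
  -- the limits `y → ∞`
  have hray := tendsto_I_mul_atTop_cocompact_inf
  have hE0 : Tendsto (fun y : ℝ ↦ E (I * y)) atTop (𝓝 0) := (hφ.tendsto_symm_sub_self hb).comp hray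
  have hyE : Tendsto (fun y : ℝ ↦ (y : ℂ) * E (I * y)) atTop (𝓝 (I * hcap K φ)) := by
    have h1 := (hφ.tendsto_mul_symm_sub_self hb).comp hray
    have h2 := h1.const_mul (-I)
    refine h2.congr' ?_ |>.trans ?_
    · filter_upwards with y
      simp only [Function.comp_apply]
      rw [← mul_assoc, ← mul_assoc, show -I * I = 1 by rw [neg_mul, I_mul_I, neg_neg], one_mul]
    · rw [show -I * -(hcap K φ : ℂ) = I * hcap K φ by ring]
  have hyEim : Tendsto (fun y : ℝ ↦ y * (E (I * y)).im) atTop (𝓝 (hcap K φ)) := by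
    have := (continuous_im.tendsto _).comp hyE
    simp only [mul_im, I_re, ofReal_im, mul_zero, I_im, ofReal_re, one_mul, zero_add] at this
    refine this.congr' ?_
    filter_upwards with y
    simp
  have hy_inv : Tendsto (fun y : ℝ ↦ (y : ℂ)⁻¹) atTop (𝓝 0) := by
    simpa using tendsto_inv_atTop_zero.ofReal
  have hwy : Tendsto (fun y : ℝ ↦ w / y) atTop (𝓝 0) := by
    simpa [div_eq_mul_inv] using hy_inv.const_mul w
  have hL : Tendsto (fun y : ℝ ↦ ‖E w - E (I * y)‖ ^ 2 * w.im) atTop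
      (𝓝 (‖E w - 0‖ ^ 2 * w.im)) := ((tendsto_const_nhds.sub hE0).norm.pow 2).mul_const _
  have hR : Tendsto (fun y : ℝ ↦ ‖w / y - I‖ ^ 2 * ((E w).im * (y * (E (I * y)).im))) atTop
      (𝓝 (‖(0 : ℂ) - I‖ ^ 2 * ((E w).im * hcap K φ))) :=
    ((hwy.sub_const I).norm.pow 2).mul (tendsto_const_nhds.mul hyEim)
  have hlim := le_of_tendsto_of_tendsto hL hR hineq
  simp only [sub_zero, zero_sub, norm_neg, norm_I, one_pow, one_mul] at hlim
  -- `|E w|² Im w ≤ Im E(w) · hcap`, and `E w = z - φ z`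
  rw [hEw] at hlim
  rw [show φ z - z = -(z - φ z) by ring, norm_neg]
  have : (z - φ z).im = z.im - (φ z).im := by simp
  rw [this] at hlim
  linarith [hlim]

/-- **The capacity displacement bound**: `|φ(z) - z| · Im φ(z) ≤ hcap(K)` for `z ∈ ℍ ∖ K`
(from the sharp form and `Im z - Im φ(z) ≤ |φ(z) - z|`). [cite: Lawler2005, §3.4 Prop. 3.36] -/
theorem norm_sub_self_mul_im_le_hcap (hφ : IsHydrodynamicMap K φ)
    (hb : IsBounded (K ∩ upperHalfPlaneSet)) {z : ℂ} (hz : z ∈ upperHalfPlaneSet \ K) :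
    ‖φ z - z‖ * (φ z).im ≤ hcap K φ := by
  have h := hφ.norm_sub_self_sq_mul_im_le hb hz
  have hcap0 : 0 ≤ hcap K φ := hφ.hcap_nonneg hb
  have him : 0 < (φ z).im := im_pos hz
  have hd : z.im - (φ z).im ≤ ‖φ z - z‖ := by
    have := abs_im_le_norm (φ z - z)
    rw [sub_im] at this
    have := neg_abs_le (φ z - z).im
    rw [sub_im] at this
    linarith
  rcases (norm_nonneg (φ z - z)).eq_or_lt with h0 | h0
  · rw [← h0, zero_mul]; exact hcap0
  · -- `|φ z - z|² Im φ z ≤ hcap · |φ z - z|`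
    have h2 : ‖φ z - z‖ ^ 2 * (φ z).im ≤ hcap K φ * ‖φ z - z‖ :=
      h.trans (mul_le_mul_of_nonneg_left hd hcap0)
    nlinarith

/-- **`|φ(z) - z| ≤ hcap(K)/Im φ(z)`.** [cite: Lawler2005, §3.4 Prop. 3.36] -/
theorem norm_sub_self_le_hcap_div_im (hφ : IsHydrodynamicMap K φ)
    (hb : IsBounded (K ∩ upperHalfPlaneSet)) {z : ℂ} (hz : z ∈ upperHalfPlaneSet \ K) :
    ‖φ z - z‖ ≤ hcap K φ / (φ z).im := by
  rw [le_div_iff₀ (im_pos hz)]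
  exact hφ.norm_sub_self_mul_im_le_hcap hb hz

end IsHydrodynamicMap

/-! ### The chosen map `hydroFun K` and the hull of a lattice past -/

/-- **`|g_K(z) - z| · Im g_K(z) ≤ hcap(K)`** for the tree's choice `g_K = hydroFun K`,
`hcap(K) = hcapOf K` (`K ∩ ℍ` bounded, `z ∈ ℍ ∖ K`). [cite: Lawler2005, §3.4 Prop. 3.36] -/
theorem norm_hydroFun_sub_self_mul_im_le {K : Set ℂ} (h : HasHydroMap K)
    (hb : IsBounded (K ∩ upperHalfPlaneSet)) {z : ℂ} (hz : z ∈ upperHalfPlaneSet \ K) :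
    ‖hydroFun K z - z‖ * (hydroFun K z).im ≤ hcapOf K := by
  rw [hydroFun_apply h hz, hcapOf_of_hasHydroMap h]
  exact (isHydrodynamicMap_hydroEquiv h).norm_sub_self_mul_im_le_hcap hb hz

namespace LatticeSlit

variable {D : DobrushinDomain} {φ : ConformalEquiv upperHalfPlaneSet D.carrier} {δ : ℝ}
  {a w : Site 2}

/-- **`|g_{K_η}(z) - z| · Im g_{K_η}(z) ≤ 2 t_η`** for the hull `K_η` of the past of a walk inside
`D` and `z ∈ ℍ ∖ K_η`: the past moves far points by `O(t_η / Im)`, uniformly in its diameter.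
[cite: Lawler2005, §3.4 Prop. 3.36 with §4.1 Remark 4.5] -/
theorem norm_hydroFun_pastHull_sub_self_mul_im_le (η : (discreteDomainGraph D.carrier δ).Walk a w)
    (hη : range (η.toCurve (meshPoint δ)) ⊆ D.carrier) {z : ℂ}
    (hz : z ∈ upperHalfPlaneSet \ pastHull φ η) :
    ‖hydroFun (pastHull φ η) z - z‖ * (hydroFun (pastHull φ η) z).im ≤ 2 * capTime φ η := by
  rw [two_mul_capTime]
  exact norm_hydroFun_sub_self_mul_im_le (hasHydroMap_pastHull η hη)
    ((isBoundedHull_pastHull (φ := φ) η hη).1.subset inter_subset_left) hz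

end LatticeSlit

end Literature.Probability.RandomPlanarGeometry

end
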